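import Mathlib
import HarnessLib
import HarnessLib.Audit
import Summits.AtomisticToContinuum.Statement
import Summits.AtomisticToContinuum.Crystallization.Theorems.CrystalLocalRigidityAssembly
import Summits.AtomisticToContinuum.Crystallization.Theorems.ExcessDecayLiouvilleCrysEnergyLimit
import Summits.AtomisticToContinuum.Crystallization.Theorems.PalmUnimodularRigidityCrysPeriodicBddBelow

/-!
Route: CrystalLocalRigidity

CLOSED (superseded) 2026-08-15T12:49:59Z by planner-AtomisticToContinuum-route-AtomisticToContinuum-CrystalLocalRigidity-0 — reason: superseded:route-AtomisticToContinuum-OneGrainWindow — superseded by route-AtomisticToContinuum-OneGrainWindow — note: route-repair (planner, 2026-08-15): CLOSED AS SUPERSEDED. This 08-13 survey route's thesis X_C = (a) Flyspeck-type local energy inequality e_loc >= e_* + (b) rigidity + (c) stacking selection + (d) ground states/min distance never acquired a distinctive TYPED crux (0620/0628 informal after 29 refute. The file is kept as the record of this route; refuted decls are indexed as negative knowledge (`ledger negatives`).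

X_C (it suffices to show, for Lennard-Jones V = r⁻¹²/12 − r⁻⁶/6 in ℝ³):
 (a) LOCAL OPTIMALITY (certified inequality, Flyspeck-type): there are R < ∞ and a "localised energy
per particle"
     e_loc(x; configuration) supported on the R-neighbourhood such that Σ_i e_loc(x_i) ≤
interactionEnergy + C·#(boundary
     particles), and e_loc ≥ e_* := ⨅_{Q periodic} energyPerParticle(Q) pointwise on every
configuration obeying the
     ground-state minimal-distance bound, with equality iff the neighbourhood is a close-packed
(Barlow) neighbourhood
     up to the optimal dilation/distortion; ε-deficit ⇒ Cε-closeness (quantitative stability).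
 (b) RIGIDITY: a configuration in which all but ε#-many R-neighbourhoods are ε-close to Barlow
neighbourhoods
     contains, after translation, blocks of ≥ M(ε) → ∞ particles that are o(1)-close to a single
Barlow stacking.
 (c) STACKING SELECTION: among Barlow stackings (with relaxed interlayer spacing and in-layer
dilation) the LJ energy
     per particle attains its infimum, and exactly at periodic stackings (expected: HCP-type, period
2).
 (d) ground states exist for every N and have a uniform (in N) positive lower bound on interparticle
distances.
(a)+(d) give E(N) ≥ N·e_* − C N^{2/3}; periodic trial blocks give E(N) ≤ N·e_* + C N^{2/3}; (c)
gives attainment of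
e_* by a periodic configuration ⇒ HasPeriodicGroundStateEnergy; (a)+(b)+(c)+(d) ⇒ every local
(vague) limit of
translated ground states is a window of an energy-minimising stacking, periodic by (c), non-zero by
(d)+(a) ⇒
IsCrystallizing.

Lean shape (formal shadow of X_C, all constants exist; the notions "Barlow neighbourhood/stacking",
"e_loc" are
definition requests):
  (∃ P : Literature.MathematicalPhysics.StatisticalMechanics.PeriodicConfiguration 3, IsLeast
(Set.range fun Q : Literature.MathematicalPhysics.StatisticalMechanics.PeriodicConfiguration 3 =>
      Q.energyPerParticle Literature.MathematicalPhysics.StatisticalMechanics.lennardJones)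
(P.energyPerParticle Literature.MathematicalPhysics.StatisticalMechanics.lennardJones))
  ∧ Filter.Tendsto (fun N : ℕ =>
Literature.MathematicalPhysics.StatisticalMechanics.groundStateEnergy
Literature.MathematicalPhysics.StatisticalMechanics.lennardJones 3 N / N) Filter.atTop
      (nhds (⨅ Q : Literature.MathematicalPhysics.StatisticalMechanics.PeriodicConfiguration 3,
Q.energyPerParticle Literature.MathematicalPhysics.StatisticalMechanics.lennardJones))
  ∧ Literature.MathematicalPhysics.StatisticalMechanics.IsCrystallizing
Literature.MathematicalPhysics.StatisticalMechanics.lennardJones 3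
→ Literature.MathematicalPhysics.StatisticalMechanics.Crystallization (→ AtomisticToContinuum given
the other three conjuncts).

Rationale: WHY THIS LINE. The only proved crystallization theorems for realistic potentials (Theil2006, d=2;
Flatley–Theil
arXiv:1407.0692 = ARMA 2015, d=3 with an auxiliary three-body term, Thm 1.1) follow one scheme: a
LOCAL energy
inequality saying close-packed neighbourhoods are optimal (sphere-packing heritage: Heitmann–Radin,
Hales/Flyspeck,
BlancLewin2015 §2.2–2.3), a discrete RIGIDITY estimate, and control of the long-range tail.
Flatley–Theil state
(p.4) that the three-body term is "of solely a technical nature" and that pure pair models are the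
expected next
step; the genuinely new 3-D obstacle for a PAIR potential is the FCC/HCP/general-Barlow-stacking
degeneracy, which
LJ breaks only at 2nd/3rd-neighbour range (Flatley–Theil p.5 item 2; BlancLewin2015 p.11: sphere
packing has
"even non-periodic" solutions). Imported areas: certified computation / interval arithmetic (crux
(a) and (c) are
finite-dimensional inequalities of Flyspeck type), discrete differential geometry (rigidity (b)),
1-D symbolic
dynamics / long-range lattice-gas ground states (stacking selection (c): Barlow stackings ↔ Hägg
±-sequences,
LJ energy = Σ_k J_k · #(aligned layer pairs at distance k), J_k ~ k⁻⁴ from the r⁻⁶ tail).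

RANKED CRUXES (rank 2 = hardest / most informative):
 2. (b)+(a)⇒positional: IsCrystallizing lennardJones 3 given energy asymptotics — rigidity for pair
potentials in
    3-D without the three-body crutch [informal].
 3. (3b) E(N)/N → ⨅_{periodic} e  [formal] — the energetic statement; lower bound is the content,
upper bound is a
    trial-state computation (filed separately as an easy formal item).
 3. (3a) the periodic infimum is attained [formal] — needs (c) + compactness over lattices/motifs at
bounded
    density and bounded-below distances.
 4. (c) stacking selection: certified computation of interlayer coefficients J_k with relaxation and
a domination
    inequality |J_2| > Σ_{k≥3} w_k |J_k| forcing period-2 (HCP-type) [informal; certified numerics].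
 5. (d) existence of ground states ∀N and uniform minimal distance [formal ×2; BlancLewin2015 §1.2,
§2.2 —
    expected to close quickly, vacuity guards for IsCrystallizing].
KILL CRITERIA. Refutation of (3a) (periodic infimum not attained — route RefuteCrystalPeriodicMin)
refutes the
conjunct itself. Refutation of (c) in the form "optimal stacking aperiodic but inf attained only in
the closure"
likewise. A counterexample to (a) for every finite R (local optimality genuinely fails for LJ, e.g.
icosahedral
neighbourhoods beat Barlow ones locally at all ranges) closes THIS route (switch to a
two-scale/Γ-convergence
line) without refuting the conjunct.
NOT DECOMPOSED YET: the form of e_loc (Voronoi-cell vs. bond-counting localisation), the choice of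
R, surface
energy N^{2/3} constants, rotations (not needed: BlancLewin2015 (16) uses translations + subsequence
only), and the
2-D warm-up (Theil2006 as Literature theorem) — all wait until crux 2 or 4 moves.
SOURCES: Theil2006; Flatley–Theil arXiv:1407.0692; BlancLewin2015 (arXiv:1504.01153) §1.2, §2.1–2.3;
Ayala–Choksi–Wirth arXiv:2506.22614 (computer-assisted crystallization proofs, method import).

History (route lifecycle, newest last):
- 2026-08-15T12:49:59Z · CLOSED superseded — superseded:route-AtomisticToContinuum-OneGrainWindow (planner-AtomisticToContinuum-route-AtomisticToContinuum-Crys)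

sub-problem: Crystallization · status: closed(superseded) · opened planner-AtomisticToContinuum-Survey-0 2026-08-13T13:20:46Z · rev 0 · ledger route-AtomisticToContinuum-CrystalLocalRigidity
GENERATED by the gate from the ledger (D-0016/17). Provers cite these decls: `theorem foo : Summit.AtomisticToContinuum.Crystallization.Theses.CrystalLocalRigidity.<Decl> := …` in Summits/AtomisticToContinuum/Crystallization/Theorems/<Name>.lean.
-/

namespace Summit.AtomisticToContinuum.Crystallization.Theses.CrystalLocalRigidity

open scoped BigOperators Topology Manifold Classical MeasureTheory ProbabilityTheory Matrix InnerProductSpace ComplexConjugate ContinuousMap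
open Filter Set Function TopologicalSpace MeasureTheory

attribute [summit_statement] _root_.Crystallization

-- item stmt-AtomisticToContinuum-0620 · crux · rank 0 · closed · moot by None · by planner — informal only, no Lean statement yet:
--   X_C: (a) certified LOCAL OPTIMALITY of close-packed (Barlow) neighbourhoods for a localised
--   Lennard-Jones energy per particle e_loc with quantitative stability, on configurations obeying the
--   ground-state minimal-distance bound; (b) RIGIDITY: almost-everywhere-Barlow neighbourhoods force
--   large single-stacking blocks after translation; (c) STACKING SELECTION: LJ energy per particle over
--   relaxed Barlow stackings attains its infimum exactly at periodic stackings (expected HCP-type); (d)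
--   ground states exist with uniform minimal distance. See route thesis for the derivation X_C ⇒
--   Crystallization.

/-- item stmt-AtomisticToContinuum-0625 · crux · rank 2 · open · by planner
Blanc–Lewin positional crystallization for Lennard-Jones in ℝ³ (conjunct (ii) itself): the route's
content is (a) local optimality + (b) rigidity for a PAIR potential in 3-D without Flatley–Theil's
auxiliary three-body term (arXiv:1407.0692 Thm 1.1, p.4) + (c) periodic optimal stacking ⇒ every
vague limit of translated ground states along a subsequence is a non-zero window of a periodic
optimal stacking. -/
@[route_item "route-AtomisticToContinuum-CrystalLocalRigidity"]
def CrysPositional : Prop :=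
  Literature.MathematicalPhysics.StatisticalMechanics.IsCrystallizing Literature.MathematicalPhysics.StatisticalMechanics.lennardJones 3

/-- item stmt-AtomisticToContinuum-0626 · support · rank 3 · closed · proved by Summit.AtomisticToContinuum.Crystallization.Theorems.crysEnergyLimit_proof @ de27d46e58f4 (prover) · by planner
Energetic crystallization: E(N)/N converges to the infimum over periodic (multi-lattice)
configurations of the LJ energy per particle in d = 3. Lower bound liminf ≥ ⨅ is the content ((a)
local optimality + (d) + surface term O(N^{2/3})); upper bound is filed separately. -/
@[route_item "route-AtomisticToContinuum-CrystalLocalRigidity"]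
def CrysEnergyLimit : Prop :=
  Filter.Tendsto (fun N : ℕ => Literature.MathematicalPhysics.StatisticalMechanics.groundStateEnergy Literature.MathematicalPhysics.StatisticalMechanics.lennardJones 3 N / N) Filter.atTop (nhds (⨅ Q : Literature.MathematicalPhysics.StatisticalMechanics.PeriodicConfiguration 3, Q.energyPerParticle Literature.MathematicalPhysics.StatisticalMechanics.lennardJones))

/-- item stmt-AtomisticToContinuum-0627 · support · rank 3 · open · by planner
The infimum over periodic configurations of ℝ³ of the Lennard-Jones energy per particle is attained
(by some lattice G and finite motif F). Needs stacking selection (c) + compactness of near-optimal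
periodic configurations at bounded density / bounded-below distances; refuted if optimal LJ
stackings are aperiodic with unattained infimum (route RefuteCrystalPeriodicMin). -/
@[route_item "route-AtomisticToContinuum-CrystalLocalRigidity"]
def CrysPeriodicMinAttained : Prop :=
  ∃ P : Literature.MathematicalPhysics.StatisticalMechanics.PeriodicConfiguration 3, IsLeast (Set.range fun Q : Literature.MathematicalPhysics.StatisticalMechanics.PeriodicConfiguration 3 => Q.energyPerParticle Literature.MathematicalPhysics.StatisticalMechanics.lennardJones) (P.energyPerParticle Literature.MathematicalPhysics.StatisticalMechanics.lennardJones)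

-- item stmt-AtomisticToContinuum-0628 · support · rank 4 · closed · moot by None · by planner — informal only, no Lean statement yet:
--   STACKING SELECTION (certified computation): encode Barlow stackings of triangular close-packed
--   layers by Hägg sequences s ∈ {±1}^ℤ; layers n, n+k are 'aligned' iff s_n+…+s_{n+k-1} ≡ 0 mod 3. For
--   Lennard-Jones r⁻¹²/12 − r⁻⁶/6 with in-layer spacing a and interlayer spacing h (both relaxed near
--   the close-packed values), the energy per particle of a stacking is e₀(a,h) + Σ_{k≥2}
--   J_k(a,h)·(density of aligned pairs at distance k), with |J_k| ≤ C k⁻⁴. CLAIM: with interval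
--   arithmetic, J_2 < 0 and |J_2(a,h)| > Σ_{k≥3} k·|J_k(a,h)| uniformly on the relevant (a,h)-box,
--   whence the minimum over all stackin

/-- item stmt-AtomisticToContinuum-0629 · support · rank 4 · closed · moot by None · by planner
Easy half of energetic crystallization: limsup E(N)/N ≤ ⨅ over periodic configurations of the LJ
energy per particle (finite blocks of a near-optimal periodic configuration as trial states;
boundary O(N^{2/3}); r⁻⁶ tail summable in d = 3; needs BddBelow of the range, from LJ stability). -/
@[route_item "route-AtomisticToContinuum-CrystalLocalRigidity"]
def CrysEnergyUpper : Prop :=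
  Filter.limsup (fun N : ℕ => Literature.MathematicalPhysics.StatisticalMechanics.groundStateEnergy Literature.MathematicalPhysics.StatisticalMechanics.lennardJones 3 N / N) Filter.atTop ≤ ⨅ Q : Literature.MathematicalPhysics.StatisticalMechanics.PeriodicConfiguration 3, Q.energyPerParticle Literature.MathematicalPhysics.StatisticalMechanics.lennardJones

/-- item stmt-AtomisticToContinuum-0716 · support · rank 4 · closed · moot by None · by planner
HÄGG DOMINATION LEMMA (combinatorial half of stacking selection; pure 1-D lattice-gas statement, no
LJ input): for couplings J_2, …, J_K with J_2 + Σ_{k=3}^{K} (k−1)|J_k| ≤ 0 and any n-periodic ±1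
sequence s, the per-period stacking energy Σ_{m<n} Σ_{k=2}^{K} J_k·1[s_m+…+s_{m+k−1} ≡ 0 mod 3]
(layers m, m+k aligned) is ≥ n·Σ_{k even ≤ K} J_k = the value of the alternating sequence (ABAB =
HCP-type). Proof: Peierls count — each bad bond s_{m+1} = s_m loses |J_2| and lies in ≤ k−1 windows
of length k; windows without bad bonds have the alternating alignment status (sum 0 or ±1 by
parity). With the certified numerics of 0670 (domination incl. tail, K → ∞ by monotone limit under Σ
k|J_k| < ∞) this settles 0671 POSITIVELY (periodic minimiser) and closes route
RefuteCrystalPeriodicMin; it is also the deterministic half of CrystalLocalRigidity crux (c) 0628.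
Suggested by refuter g2-1 on 0628. -/
@[route_item "route-AtomisticToContinuum-CrystalLocalRigidity"]
def HaggDominationPeriod2 : Prop :=
  ∀ (K n : ℕ) (J : ℕ → ℝ) (s : ℤ → ℤ), 0 < n → (∀ i, s i = 1 ∨ s i = -1) → (∀ i, s (i + n) = s i) → J 2 + ∑ k ∈ Finset.Icc 3 K, ((k : ℝ) - 1) * |J k| ≤ 0 → (n : ℝ) * ∑ k ∈ (Finset.Icc 2 K).filter (fun k => Even k), J k ≤ ∑ m ∈ Finset.range n, ∑ k ∈ Finset.Icc 2 K, (if (∑ i ∈ Finset.range k, s ((m : ℤ) + i)) % 3 = 0 then J k else 0)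

/-- item stmt-AtomisticToContinuum-0737 · support · rank 4 · open · by planner
HÄGG DOMINATION, ALL RANGES, ARBITRARY (non-periodic) Hägg sequence, finite volume with O(1)
boundary term — the Mathlib-only core from which 0671 (typed: alternatingHagg minimises
haggStackingEnergy over all Hägg sequences under summable domination) follows by dividing by n and
taking liminf (haggStackingEnergy_alternating = tsum of even J_k is in HaggStacking.lean).
Statement: for J with Σ k|J_k| < ∞ and J_2 + Σ_{k≥3}(k−1)|J_k| ≤ 0, every ±1 sequence s and every n:
n·Σ_{k≥2 even} J_k ≤ H_n(J,s) + Σ_k k|J_k|, where H_n(J,s) = Σ_{m<n} Σ'_{k≥2} J_k·1[s_m+…+s_{m+k−1}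
≡ 0 mod 3] (= Literature.MathematicalPhysics.StatisticalMechanics.haggEnergy n J s definitionally).
Proof (Peierls count as in 0716, refuters g2-0/g2-1/g3-2): b := #{m<n : s(m+1) = s(m)}; k = 2
contributes exactly J_2(n − b); for k ≥ 3 a window m..m+k−1 with all internal bonds in [0,n) and
none bad is alternating, hence aligned iff k even; windows m<n containing a bad internal bond j<n
number ≤ (k−1)b, windows with an internal bond ≥ n number ≤ k−1; so |A_k − n[k even]| ≤ (k−1)(b+1)
and RHS − LHS ≥ b(−J_2 − Σ_{k≥3}(k−1)|J_k|) − Σ_{k≥3}(k−1)|J_k| ≥ −Σ_k k|J_k|. Extends 0716 (finite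
K, periodic s) to K = ∞ and aperiodic s; -/
@[route_item "route-AtomisticToContinuum-CrystalLocalRigidity"]
def HaggDominationAllRanges : Prop :=
  ∀ (J : ℕ → ℝ) (s : ℤ → ℤ) (n : ℕ), (∀ i, s i = 1 ∨ s i = -1) → Summable (fun k : ℕ => (k : ℝ) * |J k|) → J 2 + ∑' k : ℕ, (if 3 ≤ k then ((k : ℝ) - 1) * |J k| else 0) ≤ 0 → (n : ℝ) * ∑' k : ℕ, (if 2 ≤ k ∧ Even k then J k else 0) ≤ (∑ m ∈ Finset.range n, ∑' k : ℕ, (if 2 ≤ k ∧ (∑ i ∈ Finset.range k, s ((m : ℤ) + i)) % 3 = 0 then J k else 0)) + ∑' k : ℕ, (k : ℝ) * |J k|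

/-- item stmt-AtomisticToContinuum-0630 · support · rank 5 · closed · moot by None · by planner
Lennard-Jones ground states (minimisers of the N-particle energy over injective configurations in
ℝ³) exist for every N (Blanc–Lewin 2015 §1.2: strict binding inequality + coercivity modulo
translations). Vacuity guard for IsCrystallizing. -/
@[route_item "route-AtomisticToContinuum-CrystalLocalRigidity"]
def CrysGroundStatesExist : Prop :=
  ∀ N : ℕ, ∃ x : Fin N → EuclideanSpace ℝ (Fin 3), Literature.MathematicalPhysics.StatisticalMechanics.IsGroundState Literature.MathematicalPhysics.StatisticalMechanics.lennardJones x

/-- item stmt-AtomisticToContinuum-0631 · support · rank 5 · closed · moot by None · by planner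
Uniform minimal distance: there is δ > 0 such that in every N-particle Lennard-Jones ground state in
ℝ³ all interparticle distances are ≥ δ (Blanc–Lewin 2015 §2.2). Input (d) of the route; gives
multiplicity-free, locally finite vague limits. -/
@[route_item "route-AtomisticToContinuum-CrystalLocalRigidity"]
def CrysMinDistance : Prop :=
  ∃ δ : ℝ, 0 < δ ∧ ∀ (N : ℕ) (x : Fin N → EuclideanSpace ℝ (Fin 3)), Literature.MathematicalPhysics.StatisticalMechanics.IsGroundState Literature.MathematicalPhysics.StatisticalMechanics.lennardJones x → ∀ i j, i ≠ j → δ ≤ dist (x i) (x j)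

/-- item stmt-AtomisticToContinuum-0713 · support · rank 5 · closed · moot by None · by planner
Lennard-Jones STABILITY in ℝ³ (Ruelle / Fisher–Ruelle; BlancLewin2015 §1.3 (9)): the N-particle
ground-state energy is bounded below linearly, E(N) ≥ −B·N. Shared prerequisite flagged by refuters
on 0626/0629/0627: gives IsCoboundedUnder for limsup/liminf of E(N)/N and (with the block argument)
BddBelow of the periodic energies. If vendored as a Literature fact first, downstream items take it
as a hypothesis. -/
@[route_item "route-AtomisticToContinuum-CrystalLocalRigidity"]
def CrysLjStability : Prop :=
  ∃ B : ℝ, ∀ (N : ℕ) (x : Fin N → EuclideanSpace ℝ (Fin 3)), Function.Injective x → -(B * (N : ℝ)) ≤ Literature.MathematicalPhysics.StatisticalMechanics.interactionEnergy Literature.MathematicalPhysics.StatisticalMechanics.lennardJones x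

/-- item stmt-AtomisticToContinuum-0714 · support · rank 5 · closed · proved by Summit.AtomisticToContinuum.Crystallization.Theorems.crysPeriodicBddBelow_proof (prover) · by planner
The Lennard-Jones energy per particle of periodic configurations of ℝ³ (any full-rank lattice, any
finite motif) is bounded below (by −B, the stability constant: finite blocks of Q as N-point
configurations, boundary O(N^{2/3}), r⁻⁶ tail summable in d = 3). Makes ⨅_Q e(Q) a genuine infimum
(ciInf_le usable) in 0626/0629 and in the periodisation lemma. -/
@[route_item "route-AtomisticToContinuum-CrystalLocalRigidity"]
def CrysPeriodicBddBelow : Prop :=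
  BddBelow (Set.range fun Q : Literature.MathematicalPhysics.StatisticalMechanics.PeriodicConfiguration 3 => Q.energyPerParticle Literature.MathematicalPhysics.StatisticalMechanics.lennardJones)

/-- item stmt-AtomisticToContinuum-0715 · support · rank 5 · closed · moot by None · by planner
PERIODISATION (refuter finding on 0626): for every N ≥ 1 the periodic infimum is ≤ E(N)/N —
periodise any injective N-point configuration x with lattice L·ℤ³, L > diam x + 1, motif = range x;
all cross terms have distance > 1 where V_LJ < 0, so e(x + Lℤ³) ≤ 𝓔_N(x)/N; take inf over x (needs
BddBelow of the periodic range, item crys_periodic_bddBelow). With 0629 (limsup ≤ ⨅) and stability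
this yields 0626, showing 0626 is thermodynamic-limit bookkeeping and 0627 carries the energetic
content. -/
@[route_item "route-AtomisticToContinuum-CrystalLocalRigidity"]
def CrysPeriodisationLe : Prop :=
  ∀ N : ℕ, 0 < N → (⨅ Q : Literature.MathematicalPhysics.StatisticalMechanics.PeriodicConfiguration 3, Q.energyPerParticle Literature.MathematicalPhysics.StatisticalMechanics.lennardJones) ≤ Literature.MathematicalPhysics.StatisticalMechanics.groundStateEnergy Literature.MathematicalPhysics.StatisticalMechanics.lennardJones 3 N / N

/-- item stmt-AtomisticToContinuum-0622 · assembly · rank 1 · closed · proved by Literature.StatMech.crystallization_of_isLeast_tendsto_isCrystallizing (refuter) · by planner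
Formal shadow of the assembly: (periodic infimum attained) ∧ (E(N)/N → inf over periodic
configurations of the LJ energy per particle) ∧ IsCrystallizing lennardJones 3 → Crystallization
(unfold HasPeriodicGroundStateEnergy: the least P has e(P) = ⨅). -/
@[route_item "route-AtomisticToContinuum-CrystalLocalRigidity"]
def Assembly : Prop :=
  (∃ P : Literature.MathematicalPhysics.StatisticalMechanics.PeriodicConfiguration 3, IsLeast (Set.range fun Q : Literature.MathematicalPhysics.StatisticalMechanics.PeriodicConfiguration 3 => Q.energyPerParticle Literature.MathematicalPhysics.StatisticalMechanics.lennardJones) (P.energyPerParticle Literature.MathematicalPhysics.StatisticalMechanics.lennardJones)) ∧ Filter.Tendsto (fun N : ℕ => Literature.MathematicalPhysics.StatisticalMechanics.groundStateEnergy Literature.MathematicalPhysics.StatisticalMechanics.lennardJones 3 N / N) Filter.atTop (nhds (⨅ Q : Literature.MathematicalPhysics.StatisticalMechanics.PeriodicConfiguration 3, Q.energyPerParticle Literature.MathematicalPhysics.StatisticalMechanics.lennardJones)) ∧ Literature.MathematicalPhysics.StatisticalMechanics.IsCrystallizing Literature.MathematicalPhysics.StatisticalMechanics.lennardJones 3 →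 Literature.MathematicalPhysics.StatisticalMechanics.Crystallization

/-- `Assembly` holds: proved by `Literature.StatMech.crystallization_of_isLeast_tendsto_isCrystallizing`. -/
theorem Assembly_holds : Assembly := _root_.Literature.StatMech.crystallization_of_isLeast_tendsto_isCrystallizing

/-- item stmt-AtomisticToContinuum-0624 · assembly · rank 1 · closed · proved by Literature.StatMech.atomisticToContinuum_of_conjuncts (refuter) · by planner
Summit assembly: the four conjuncts imply AtomisticToContinuum (AtomisticToContinuum_iff). Shared by
all routes. -/
@[route_item "route-AtomisticToContinuum-CrystalLocalRigidity"]
def Assembly2 : Prop :=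
  Literature.MathematicalPhysics.KineticTheory.HydrodynamicLimit ∧ Literature.MathematicalPhysics.KineticTheory.HeatConduction.FouriersLaw ∧ Literature.MathematicalPhysics.StatisticalMechanics.Crystallization ∧ Literature.MathematicalPhysics.QuantumManyBody.BoseGas.BoseEinsteinCondensation → AtomisticToContinuum

/-- `Assembly2` holds: proved by `Literature.StatMech.atomisticToContinuum_of_conjuncts`. -/
theorem Assembly2_holds : Assembly2 := _root_.Literature.StatMech.atomisticToContinuum_of_conjuncts

end Summit.AtomisticToContinuum.Crystallization.Theses.CrystalLocalRigidity
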